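import Summits.HubbardSuperconductivity.HubbardSuperconductivity.Theses.InfiniteVolumeFirst
import Literature.MathematicalPhysics.QuantumLattice.InfVolFermionStateCompactness

/-!
# Crux `NoNormalLimitState` (stmt-HubbardSuperconductivity-18533, route `InfiniteVolumeFirst`) —
# the crux is a statement about infinite-volume STATES: its per-state form is equivalent

The crux quantifies over admissible ground-state families `ψ`, strictly increasing even side
sequences `Ls` and pointwise limit FUNCTIONS `C : ℤ² → ℝ` of the translation-averaged `d`-wave pair
correlations, and asks `liminf_R R⁻⁴ Σ_{x,y∈[0,R)²} C(x-y) > 0`.  With the infinite-volume states of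
the lattice fermion system now in the tree (`InfVolFermionState`, `IsTorusLimitOf`) and the weak-⋆
compactness theorem `InfVolFermionState.exists_isTorusLimitOf_subseq` (Literature,
`InfVolFermionStateCompactness.lean`), the limit-function bookkeeping can be deleted rigorously:

* `stub_noNormalLimitState_iff_perState` : `NoNormalLimitState ↔` (same `δ/U/family/Ls` prefix)
  `∀ ω : InfVolFermionState 2, ω.IsTorusLimitOf ψ Ls → 0 < liminf_R R⁻⁴ Σ_{x,y} Re ω(P_{x-y}⋆ P_0)`,
  i.e. EVERY thermodynamic-limit state of every admissible family has `d_{x²-y²}` off-diagonal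
  long-range order (Sewell's ODLRO of a state of the quasi-local algebra).  `→`: the pair
  correlations of a torus-limit state ARE a pointwise limit function (tree dictionary
  `IsTorusLimitOf.tendsto_sum_torusPullback_pairFieldCorr_dWave`).  `←`: given a limit function `C`
  along `Ls`, compactness extracts a torus-limit state `ω` along a subsequence, and `C = Re ω(P⋆P)`
  (`IsTorusLimitOf.eq_re_pairCorr`), so the per-state atom is the atom of `C`.
* `noNormalLimitState_of_minimiserExclusion` : the composition of the idea card
  `bkr-minimiser-exclusion` with its compactness stub DISCHARGED — if torus limits of admissible
  families are density-`(1-δ)` minimisers of the Hubbard energy density among translation-invariant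
  even states (the Bratteli–Kishimoto–Robinson / Araki–Moriya variational principle for this model,
  hypothesis `hmin`, not proved here) and no such minimiser is `d`-wave normal at some doping and
  cofinally small coupling (the hard per-state statement, hypothesis `hexcl`), then the crux holds.

Pure logic over landed theorems; no definition, no named fact.  The crux itself is NOT advanced
(open-problem strength, see the item's census); this file fixes its exact infinite-volume meaning.
-/

noncomputable section

-- the mandated namespace `Summit.<Summit>.<Problem>.Theorems` repeats `HubbardSuperconductivity`
-- (single-problem summit, D-0017), which the `dupNamespace` linter flags on every declaration
set_option linter.dupNamespace false

namespace Summit.HubbardSuperconductivity.HubbardSuperconductivity.Theorems.NoNormalLimitState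

open Literature.MathematicalPhysics.QuantumLattice Literature.Probability.LatticeModels Filter
open scoped Topology

/-- **The crux is its per-state form.** `NoNormalLimitState` holds iff: there is `δ ∈ (0,1/2)` such
that for every `U₀ > 0` some `U ∈ (0,U₀)` has — for every admissible family
(`N_L = 2⌊(1-δ)L²/2⌋`, `ψ_L` a normalised `(N_L, S^z=0)`-sector ground state of `hubbardTorus 2 L 1 U`
at even `L`), every strictly increasing sequence of even sides `Ls` and EVERY infinite-volume state
`ω` that is a torus limit of `ψ` along `Ls` — a positive `d`-wave condensate atom
`liminf_R R⁻⁴ Σ_{x,y∈[0,R)²} Re ω(P_{x-y}⋆ P_0) > 0` (ODLRO of the limit state). [folklore] -/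
theorem stub_noNormalLimitState_iff_perState :
    Summit.HubbardSuperconductivity.HubbardSuperconductivity.Theses.InfiniteVolumeFirst.NoNormalLimitState ↔
      ∃ δ ∈ Set.Ioo (0:ℝ) (1 / 2), ∀ U₀ : ℝ, 0 < U₀ → ∃ U ∈ Set.Ioo (0:ℝ) U₀,
        ∀ (N : ℕ → ℕ) (ψ : ∀ L, Fock (Orb (FermionTorus 2 L))),
          (∀ L, Even L → N L = 2 * ⌊(1 - δ) * (L : ℝ) ^ 2 / 2⌋₊ ∧ star (ψ L) ⬝ᵥ ψ L = 1 ∧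
              IsGroundStateInSector (hubbardTorus 2 L 1 U) (N L) 0 (ψ L)) →
            ∀ (Ls : ℕ → ℕ) (ω : InfVolFermionState 2), StrictMono Ls → (∀ j, Even (Ls j)) →
              ω.IsTorusLimitOf ψ Ls →
                0 < liminf (fun R : ℕ => (∑ x ∈ halfOpenBox 2 R, ∑ y ∈ halfOpenBox 2 R,
                  (ω.dWavePairCorr (x - y) 0).re) / ((R : ℕ) : ℝ) ^ 4) atTop := by
  constructor
  · rintro ⟨δ, hδ, h⟩
    refine ⟨δ, hδ, fun U₀ hU₀ => ?_⟩
    obtain ⟨U, hU, hA⟩ := h U₀ hU₀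
    refine ⟨U, hU, fun N ψ hadm Ls ω hLs hev hω => ?_⟩
    exact hA N ψ hadm Ls (fun x => (ω.dWavePairCorr x 0).re) hLs hev
      (fun x => hω.tendsto_sum_torusPullback_pairFieldCorr_dWave hLs.tendsto_atTop x)
  · rintro ⟨δ, hδ, h⟩
    refine ⟨δ, hδ, fun U₀ hU₀ => ?_⟩
    obtain ⟨U, hU, hA⟩ := h U₀ hU₀
    refine ⟨U, hU, fun N ψ hadm Ls C hLs hev hC => ?_⟩
    have hnorm : ∀ j, star (ψ (Ls j)) ⬝ᵥ ψ (Ls j) = 1 := fun j => (hadm _ (hev j)).2.1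
    obtain ⟨φ, hφ, ω, hω⟩ :=
      InfVolFermionState.exists_isTorusLimitOf_subseq ψ hLs.tendsto_atTop hnorm
    have hLφ : StrictMono (Ls ∘ φ) := hLs.comp hφ
    have hC' : ∀ x : Site 2, Tendsto (fun j : ℕ => (∑ y ∈ halfOpenBox 2 ((Ls ∘ φ) j),
        torusPullback (pairFieldCorr dWaveFormFactor ψ) ((Ls ∘ φ) j) (x + y) y) /
          (((Ls ∘ φ) j : ℕ) : ℝ) ^ 2) atTop (𝓝 (C x)) := fun x => (hC x).comp hφ.tendsto_atTop
    have hCeq : C = fun x => (ω.dWavePairCorr x 0).re :=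
      funext fun x => hω.eq_re_pairCorr dWaveFormFactor hLφ.tendsto_atTop hC' x
    rw [hCeq]
    exact hA N ψ hadm (Ls ∘ φ) ω hLφ (fun j => hev (φ j)) hω

/-- **Minimiser exclusion implies the crux** (idea card `bkr-minimiser-exclusion`, its compactness
stub discharged by `InfVolFermionState.exists_isTorusLimitOf_subseq`).  Hypotheses, both in the
tree's infinite-volume vocabulary: `hmin` — every torus-limit state of an admissible family at
`(U, δ)` has particle density `1 - δ` and minimises the Hubbard energy density `e(·)` (`t = 1`,
coupling `U`) among translation-invariant even states of that density (Bratteli–Kishimoto–Robinson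
variational principle for the model; NOT proved here); `hexcl` — at some `δ ∈ (0,1/2)` and
cofinally small `U`, no translation-invariant even density-`(1-δ)` minimiser is `d`-wave normal.
Then `NoNormalLimitState` (torus limits are translation invariant and even by the tree's structural
theorems, so `hexcl` applies to them; conclude by the per-state form).
[cite: BratteliKishimotoRobinson1978, §3 Thm. 2 (invariant ground states minimise the mean energy)] -/
theorem noNormalLimitState_of_minimiserExclusion
    (hmin : ∀ (δ U : ℝ) (N : ℕ → ℕ) (ψ : ∀ L, Fock (Orb (FermionTorus 2 L))),
      δ ∈ Set.Ioo (0:ℝ) (1 / 2) → 0 < U →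
        (∀ L, Even L → N L = 2 * ⌊(1 - δ) * (L : ℝ) ^ 2 / 2⌋₊ ∧ star (ψ L) ⬝ᵥ ψ L = 1 ∧
            IsGroundStateInSector (hubbardTorus 2 L 1 U) (N L) 0 (ψ L)) →
          ∀ (Ls : ℕ → ℕ) (ω : InfVolFermionState 2), StrictMono Ls → (∀ j, Even (Ls j)) →
            ω.IsTorusLimitOf ψ Ls →
              ω.density = 1 - δ ∧ ∀ ω' : InfVolFermionState 2, ω'.IsTranslationInvariant →
                ω'.IsEven → ω'.density = 1 - δ →
                  ω.hubbardEnergyDensity 1 U ≤ ω'.hubbardEnergyDensity 1 U)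
    (hexcl : ∃ δ ∈ Set.Ioo (0:ℝ) (1 / 2), ∀ U₀ : ℝ, 0 < U₀ → ∃ U ∈ Set.Ioo (0:ℝ) U₀,
      ∀ ω : InfVolFermionState 2, ω.IsTranslationInvariant → ω.IsEven → ω.density = 1 - δ →
        (∀ ω' : InfVolFermionState 2, ω'.IsTranslationInvariant → ω'.IsEven →
            ω'.density = 1 - δ → ω.hubbardEnergyDensity 1 U ≤ ω'.hubbardEnergyDensity 1 U) →
          0 < liminf (fun R : ℕ => (∑ x ∈ halfOpenBox 2 R, ∑ y ∈ halfOpenBox 2 R,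
            (ω.dWavePairCorr (x - y) 0).re) / ((R : ℕ) : ℝ) ^ 4) atTop) :
    Summit.HubbardSuperconductivity.HubbardSuperconductivity.Theses.InfiniteVolumeFirst.NoNormalLimitState := by
  obtain ⟨δ, hδ, h⟩ := hexcl
  refine stub_noNormalLimitState_iff_perState.2 ⟨δ, hδ, fun U₀ hU₀ => ?_⟩
  obtain ⟨U, hU, hω⟩ := h U₀ hU₀
  refine ⟨U, hU, fun N ψ hadm Ls ω hLs hev hlim => ?_⟩
  have hN : ∀ j, IsNParticle (N (Ls j)) (ψ (Ls j)) := fun j =>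
    ((mem_szSector_iff _ _ _).1 (hadm _ (hev j)).2.2.1).1
  obtain ⟨hdens, hle⟩ := hmin δ U N ψ hδ hU.1 hadm Ls ω hLs hev hlim
  -- evenness needs the particle number only along the sequence: pass to the limit along `Ls`
  have heven : ω.IsEven := by
    intro Λ A
    refine tendsto_nhds_unique (hlim Λ (parityAut A)) ?_
    have : ∀ j, torusAvgExpect (Ls j) Λ (parityAut A) (ψ (Ls j)) =
        torusAvgExpect (Ls j) Λ A (ψ (Ls j)) := fun j => torusAvgExpect_parityAut _ Λ A (hN j)
    simp_rw [this]
    exact hlim Λ A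
  exact hω ω hlim.isTranslationInvariant heven hdens hle

end Summit.HubbardSuperconductivity.HubbardSuperconductivity.Theorems.NoNormalLimitState

end
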